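import Literature.Computability.Cryptography.CryptoFoundationsWave0
import Mathlib.Analysis.SpecificLimits.Normed
import Mathlib.Analysis.SpecialFunctions.Sqrt
import HarnessLib

/-!
# A negligible, antitone envelope for `m ↦ m^c · 2^{-m}` over all `m ≥ n`

Topic `Computability/Cryptography`; sequel of `CryptoFoundationsWave0.lean` (`IsNegligible`). In a reduction whose
circuit at input length `m` works with precision parameters polynomial in `m` (e.g. Regev's one-copy sampler, J. ACM
56 (2009), Lemma 3.14: `k = k(m)` bits of rotation precision, error terms `poly(m) · 2^{-Ω(k(m))}`), the security
parameter of the statement is the DIMENSION `n ≤ m`, and the error must be bounded by a negligible function of `n`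
uniformly over all input lengths `m ≥ n`. This file supplies the envelope:

* `exists_bound_pow_mul_sqrt_two_inv_pow` — `m^c · (1/√2)^m` is bounded;
* **`exists_negligible_envelope`** — for every `c` there is a nonnegative, antitone, negligible `ν` with
  `m^c · 2^{-m} ≤ ν n` for all `m ≥ n`.

Everything is proved; no definition, no named fact is introduced.

## References

* O. Goldreich, *Foundations of Cryptography* I, CUP 2001, §1.3.3, Def. 1.3.5 (negligible functions) [Goldreich2001].
* J. Katz, Y. Lindell, *Introduction to Modern Cryptography*, 2nd ed., CRC 2014, §3.1.2 Prop. 3.6 (closure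
  properties of negligible functions) [KatzLindell2014].
* O. Regev, *On lattices, learning with errors, random linear codes, and cryptography*, J. ACM 56 (2009), art. 34,
  Lemma 3.14 (proof: "with exponentially small error") [Regev2009].
-/

noncomputable section

namespace Literature.Computability.Cryptography

open Filter Asymptotics Topology

/-- **`m^c · (1/√2)^m` is bounded** (it tends to `0`). [cite: KatzLindell2014, §3.1.2 Prop. 3.6] -/
theorem exists_bound_pow_mul_sqrt_two_inv_pow (c : ℕ) :
    ∃ K : ℝ, 0 ≤ K ∧ ∀ m : ℕ, (m : ℝ) ^ c * (Real.sqrt 2)⁻¹ ^ m ≤ K := by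
  have hr : |(Real.sqrt 2)⁻¹| < 1 := by
    rw [abs_of_pos (by positivity), inv_lt_one_iff₀]
    exact Or.inr (by rw [show (1 : ℝ) = Real.sqrt 1 from Real.sqrt_one.symm]; exact Real.sqrt_lt_sqrt zero_le_one one_lt_two)
  have ht := tendsto_pow_const_mul_const_pow_of_abs_lt_one c hr
  obtain ⟨K, hK⟩ := ht.bddAbove_range
  refine ⟨max K 0, le_max_right _ _, fun m => (hK ⟨m, rfl⟩).trans (le_max_left _ _)⟩

/-- **A negligible antitone envelope**: for every exponent `c` there is `ν ≥ 0`, antitone and negligible, with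
`m^c · 2^{-m} ≤ ν(n)` for all `m ≥ n`. [cite: Goldreich2001, §1.3.3 Def. 1.3.5] [cite: Regev2009, Lemma 3.14 (proof)] -/
theorem exists_negligible_envelope (c : ℕ) :
    ∃ ν : ℕ → ℝ, IsNegligible ν ∧ (∀ n, 0 ≤ ν n) ∧ Antitone ν ∧
      ∀ n m : ℕ, n ≤ m → (m : ℝ) ^ c * (2⁻¹ : ℝ) ^ m ≤ ν n := by
  obtain ⟨K, hK0, hK⟩ := exists_bound_pow_mul_sqrt_two_inv_pow c
  set r : ℝ := (Real.sqrt 2)⁻¹ with hr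
  have hr0 : 0 ≤ r := by positivity
  have hr1 : r ≤ 1 := by
    rw [hr, inv_le_one_iff₀]
    exact Or.inr (by rw [show (1 : ℝ) = Real.sqrt 1 from Real.sqrt_one.symm]; exact Real.sqrt_le_sqrt one_le_two)
  have hrabs : |r| < 1 := by
    rw [abs_of_nonneg hr0, hr, inv_lt_one_iff₀]
    exact Or.inr (by rw [show (1 : ℝ) = Real.sqrt 1 from Real.sqrt_one.symm]; exact Real.sqrt_lt_sqrt zero_le_one one_lt_two)
  have hrr : ∀ m : ℕ, (2⁻¹ : ℝ) ^ m = r ^ m * r ^ m := fun m => by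
    rw [← mul_pow, hr, ← mul_inv, Real.mul_self_sqrt zero_le_two]
  refine ⟨fun n => K * r ^ n, ?_, fun n => mul_nonneg hK0 (pow_nonneg hr0 n), ?_, ?_⟩
  · -- negligible: `n^c · (K r^n) = K · (n^c r^n) → 0`
    intro d
    have ht := (tendsto_pow_const_mul_const_pow_of_abs_lt_one d hrabs).const_mul K
    rw [mul_zero] at ht
    refine ht.congr fun n => ?_
    simp only
    ring
  · exact fun n n' h => mul_le_mul_of_nonneg_left (pow_le_pow_of_le_one hr0 hr1 h) hK0
  · intro n m hnm
    calc (m : ℝ) ^ c * (2⁻¹ : ℝ) ^ m = (m : ℝ) ^ c * r ^ m * r ^ m := by rw [hrr, mul_assoc]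
      _ ≤ K * r ^ m := mul_le_mul_of_nonneg_right (hK m) (pow_nonneg hr0 m)
      _ ≤ K * r ^ n := mul_le_mul_of_nonneg_left (pow_le_pow_of_le_one hr0 hr1 hnm) hK0

end Literature.Computability.Cryptography

end
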